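import Mathlib.CategoryTheory.SingleObj
import Mathlib.CategoryTheory.Endomorphism
import Mathlib.Algebra.Order.Positive.Field
import Mathlib.Data.PNat.Basic
import Mathlib.Data.Rat.Defs
import Mathlib.Algebra.Order.Field.Rat
import Mathlib.Tactic.FieldSimp
import Mathlib.Tactic.Ring
import Literature.AlgebraicGeometry.Frobenioids.Categories
import Literature.AlgebraicGeometry.Frobenioids.ElementaryFrobenioid
import HarnessLib

/-!
# Frobenioids I, §3: the base `G = ℚ ⋊ (N_{≥1})^gp` of Examples 3.8, 3.9 (and 4.7 (ii))

Mochizuki, *The geometry of Frobenioids I: the general theory*, Kyushu J. Math. **62** (2008)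
293–400, kurims text pp. 71–72, 87 [cite: MochizukiFrdI2008, Ex. 3.8 p.71].  Common data of
Examples 3.8, 3.9 (pp. 71–72) and 4.7 (ii) (p. 87): `N := (N_{≥1})^gp` (rendered as the
multiplicative group of positive rationals, with the embedding `N_{≥1} ↪ N`), `U := ℚ`, and the
semi-direct product `G := U ⋊ N` "where we let `n ∈ N (⊆ ℚ)` act on `U` by `n⁻¹`", i.e.
`(u₁, n₁) · (u₂, n₂) = (u₁ + n₁⁻¹ u₂, n₁ n₂)` (the `U`- and `N`-coordinates of the printed law of `M`,
p. 71); the one-object category `D` with endomorphism monoid `G`; and the injection of monoids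
`𝔽 ↪ G`, `(a, d) ↦ (a, d⁻¹)` ("since there exist injections of monoids `𝔽 ↪ G`, it thus follows that
`D` fails to be Frobenius-slim", p. 71 — the injection is PROVED here; Frobenius-slimness itself is
[FrdI] Def. 3.1 (i), seat abc-iut-L1-t3, and the conclusion is typed in the §3 glue file).
`𝔽` is found's `StandardFrobenioid` (`ElementaryFrobenioid.lean`).  No statement is strengthened.
-/

namespace Literature.AlgebraicGeometry.Frobenioids

open CategoryTheory

namespace RatSemidirect

/-- `N := (N_{≥1})^gp`, rendered as the multiplicative group `ℚ_{>0}` of positive rationals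
(FrdI Ex. 3.8 p. 71: "`N := (N_{≥1})^gp` [so … `N (⊆ ℚ)`]"). [cite: MochizukiFrdI2008, Ex. 3.8 p.71] -/
abbrev N : Type := {q : ℚ // 0 < q}

/-- The embedding `N_{≥1} ↪ N = (N_{≥1})^gp`. [cite: MochizukiFrdI2008, Ex. 3.8 p.71] -/
def natPos : ℕ+ →* N where
  toFun m := ⟨(m : ℚ), by exact_mod_cast m.pos⟩
  map_one' := Subtype.ext (by simp)
  map_mul' a b := Subtype.ext (by simp [Positive.val_mul])

/-- Values of `natPos`. [cite: MochizukiFrdI2008, Ex. 3.8 p.71] -/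
@[simp] theorem natPos_val (m : ℕ+) : (natPos m : ℚ) = m := rfl

/-- `natPos` is injective. [cite: MochizukiFrdI2008, Ex. 3.8 p.71] -/
theorem natPos_injective : Function.Injective natPos := by
  intro a b h
  have h' : ((a : ℕ) : ℚ) = (b : ℕ) := congrArg Subtype.val h
  exact PNat.coe_injective (by exact_mod_cast h')

/-- `G := U ⋊ N`, `U = ℚ`, "where we let `n ∈ N (⊆ ℚ)` act on `U` by `n⁻¹`" (FrdI Ex. 3.8 p. 71; the
same `G` in Ex. 3.9 p. 71 and, as `V ⋊ N`, in Ex. 4.7 (ii) p. 87). [cite: MochizukiFrdI2008, Ex. 3.8 p.71] -/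
@[ext] structure G : Type where
  /-- the `U = ℚ` coordinate -/
  u : ℚ
  /-- the `N = ℚ_{>0}` coordinate -/
  n : N

namespace G

/-- The printed multiplication `(u₁, n₁) · (u₂, n₂) = (u₁ + n₁⁻¹ · u₂, n₁ · n₂)` (FrdI p. 71, the `U`-
and `N`-coordinates of the law of `M`). [cite: MochizukiFrdI2008, Ex. 3.8 p.71] -/
instance instGroup : Group G where
  mul x y := ⟨x.u + (x.n : ℚ)⁻¹ * y.u, x.n * y.n⟩
  one := ⟨0, 1⟩
  inv x := ⟨-(x.n : ℚ) * x.u, x.n⁻¹⟩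
  mul_assoc x y z := by
    refine G.ext ?_ (mul_assoc _ _ _)
    show x.u + (x.n : ℚ)⁻¹ * y.u + ((x.n * y.n : N) : ℚ)⁻¹ * z.u =
      x.u + (x.n : ℚ)⁻¹ * (y.u + (y.n : ℚ)⁻¹ * z.u)
    rw [Positive.val_mul, mul_inv]
    ring
  one_mul x := by
    refine G.ext ?_ (one_mul _)
    show 0 + ((1 : N) : ℚ)⁻¹ * x.u = x.u
    simp [Positive.val_one]
  mul_one x := by
    refine G.ext ?_ (mul_one _)
    show x.u + (x.n : ℚ)⁻¹ * 0 = x.u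
    simp
  inv_mul_cancel x := by
    refine G.ext ?_ (inv_mul_cancel _)
    show -(x.n : ℚ) * x.u + ((x.n⁻¹ : N) : ℚ)⁻¹ * x.u = 0
    rw [Positive.coe_inv, inv_inv]
    ring

/-- Components of the product in `G`. [cite: MochizukiFrdI2008, Ex. 3.8 p.71] -/
@[simp] theorem mul_u (x y : G) : (x * y).u = x.u + (x.n : ℚ)⁻¹ * y.u := rfl

/-- Components of the product in `G`. [cite: MochizukiFrdI2008, Ex. 3.8 p.71] -/
@[simp] theorem mul_n (x y : G) : (x * y).n = x.n * y.n := rfl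

/-- The unit of `G`. [cite: MochizukiFrdI2008, Ex. 3.8 p.71] -/
@[simp] theorem one_u : (1 : G).u = 0 := rfl

/-- The unit of `G`. [cite: MochizukiFrdI2008, Ex. 3.8 p.71] -/
@[simp] theorem one_n : (1 : G).n = 1 := rfl

end G

/-- `D`: "the one-object category whose unique object has endomorphism monoid `G`" (FrdI Ex. 3.8,
3.9 p. 71; Ex. 4.7 (ii) p. 87). [cite: MochizukiFrdI2008, Ex. 3.8 p.71] -/
abbrev D : Type := SingleObj G

/-- The subgroup `U ⊆ G` (`n = 1`). [cite: MochizukiFrdI2008, Ex. 3.8 p.71] -/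
def inU (u : ℚ) : G := ⟨u, 1⟩

/-- "there exist injections of monoids `𝔽 ↪ G`" (FrdI Ex. 3.8 p. 71): `(a, d) ↦ (a, d⁻¹)` — the law
`(a₁, d₁)(a₂, d₂) = (a₁ + d₁ a₂, d₁ d₂)` of `𝔽 = F_{ℤ_{≥0}}` matches `(u₁ + n₁⁻¹ u₂, n₁ n₂)` with `n = d⁻¹`.
[cite: MochizukiFrdI2008, Ex. 3.8 p.71] -/
def frobToG : StandardFrobenioid →* G where
  toFun x := ⟨(Multiplicative.toAdd x.div : ℕ), (natPos x.degFr)⁻¹⟩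
  map_one' := by
    refine G.ext ?_ ?_
    · show ((Multiplicative.toAdd (1 : StandardFrobenioid).div : ℕ) : ℚ) = 0
      simp
    · show (natPos (1 : StandardFrobenioid).degFr)⁻¹ = 1
      simp
  map_mul' x y := by
    refine G.ext ?_ ?_
    · show ((Multiplicative.toAdd (x * y).div : ℕ) : ℚ) =
        (Multiplicative.toAdd x.div : ℕ) + (((natPos x.degFr)⁻¹ : N) : ℚ)⁻¹ * (Multiplicative.toAdd y.div : ℕ)
      simp only [ElemFrobenioidMonoid.mul_div, toAdd_mul, toAdd_pow, smul_eq_mul, Nat.cast_add,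
        Nat.cast_mul, Positive.coe_inv, inv_inv, natPos_val]
    · show (natPos (x * y).degFr)⁻¹ = (natPos x.degFr)⁻¹ * (natPos y.degFr)⁻¹
      rw [ElemFrobenioidMonoid.mul_degFr, map_mul, mul_inv]

/-- The injection `𝔽 ↪ G` is injective. [cite: MochizukiFrdI2008, Ex. 3.8 p.71] -/
theorem frobToG_injective : Function.Injective frobToG := by
  intro x y h
  have hu := congrArg G.u h
  have hn := congrArg G.n h
  change ((Multiplicative.toAdd x.div : ℕ) : ℚ) = (Multiplicative.toAdd y.div : ℕ) at hu
  change (natPos x.degFr)⁻¹ = (natPos y.degFr)⁻¹ at hn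
  refine ElemFrobenioidMonoid.ext ?_ ?_
  · have hu' : (Multiplicative.toAdd x.div : ℕ) = Multiplicative.toAdd y.div := by
      exact_mod_cast hu
    exact Multiplicative.toAdd.injective hu'
  · exact natPos_injective (inv_injective hn)

end RatSemidirect

end Literature.AlgebraicGeometry.Frobenioids
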